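import Summits.Ventures.PercRepro.ProfileGapMonoOne
import Summits.Ventures.PercRepro.ProfileGapMonoTop

/-!
# PercRepro — (GM)_1 AT EVERY POINT OF EVERY SIMPLE MATROID: the coloop case, the trivial levels, and the wrap-up
(p10, gen 7; `proofs/P10-AVFULL.md` §9)

**THEOREM** (`gapMonoQ_one_of_simple_all`): for every simple matroid `M`, every point `z ∈ E` and every `u ≥ 2`,
`GapMonoQ M z 1 u` — the instance `q = 1` of the gap-monotonicity conjecture of ProfileGapMonoQ holds at EVERY
point of EVERY simple matroid, at every level.  Cases: `ρ(E) < u` (both sides vanish, `gapMonoQ_of_rk_lt`);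
`ρ(E) = u` (the top level, `gapMonoQ_top`); `ρ(E) ≥ u + 1` and `z` not a coloop (`gapMonoQ_one_of_simple`,
the series-class count); `ρ(E) ≥ u + 1` and `z` a coloop (`gapMonoQ_one_of_simple_coloop`, this file): then
`M ／ z = M ∖ z =: N`, the demand of every point `x ≠ z` drops by its demand in `N` at level `u − 1` plus one if
`ρ(E ∖ x) = u`, the supply is `#{A : ρ_N(A) = u − 1} + [ρ(N) = u]`, and the tree's row `q = 1` on `N` at level
`u − 1` (`hallIneq_one_all`, `profileIneq_of_hallIneq`) together with the basis bound and `#coloops(N) ≤ ρ(N)`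
close the inequality.

* `gapMonoQ_of_rk_lt`, `rk_erase_of_coloop`, `demand_singleton_coloop_add`, **`gapMonoQ_one_of_simple_coloop`**,
  **`gapMonoQ_one_of_simple_all`**.
-/

open scoped Matroid

namespace PercRepro.Cogirth

open Finset ThmH Skew Shadow Profile

variable {α : Type} [DecidableEq α] {M : Matroid α} [M.Finite]

/-- Below the rank everything vanishes: `GapMonoQ M z q u` for `ρ(E) < u`. -/
theorem gapMonoQ_of_rk_lt {q u : ℕ} (hR : rk M (gr M) < u) (z : α) : GapMonoQ M z q u := by
  unfold GapMonoQ
  have hlev : ∀ (N : Matroid α) [N.Finite], rk N (gr N) < u → levelSetCoQ N q u = ∅ := by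
    intro N _ hN
    rw [eq_empty_iff_forall_notMem]
    intro S hS
    rw [mem_levelSetCoQ] at hS
    have h := rk_mono_sub (M := N) hS.1.1
    have hr : rk N S = u := by unfold rk; rw [hS.1.2, ENat.toNat_coe]
    omega
  have hdem : ∀ (N : Matroid α) [N.Finite], rk N (gr N) < u → ∀ B, demand N q u B = 0 := by
    intro N _ hN B
    unfold demand
    rw [if_neg]
    have := rk_mono_sub (M := N) (sdiff_subset : gr N \ B ⊆ gr N)
    omega
  have hdel : rk (M ＼ ({z} : Set α)) (gr (M ＼ ({z} : Set α))) < u := by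
    rw [gr_delete', rk_delete (Subset.refl _)]
    exact lt_of_le_of_lt (rk_mono_sub (erase_subset _ _)) hR
  rw [hlev M hR, hlev _ hdel, sum_eq_zero (fun B _ => hdem M hR B), sum_eq_zero (fun B _ => hdem _ hdel B)]

/-- For a coloop `z` of `M` and `X ∋ z`, `ρ(X ∖ z) + 1 = ρ(X)`. -/
theorem rk_erase_of_coloop {z : α} (hz : z ∈ gr M) (hzc : rk M ((gr M).erase z) + 1 = rk M (gr M))
    {X : Finset α} (hX : X ⊆ gr M) (hzX : z ∈ X) : rk M (X.erase z) + 1 = rk M X := by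
  have hcl : z ∉ clF M (X.erase z) := by
    intro h
    have h' : z ∈ clF M ((gr M).erase z) := clF_mono_sub (erase_subset_erase z hX) h
    rw [mem_clF_iff_rk_insert_eq hz (erase_subset _ _), insert_erase hz] at h'
    omega
  have h := rk_insert_eq (M := M) hz (X := X.erase z) ((erase_subset _ _).trans hX)
  rw [insert_erase hzX, if_neg hcl] at h
  omega

/-- **The demand of a point under the deletion of a coloop `z`**: for `x ≠ z`,
`demand_M(x) = demand_{M∖z}(x) + demand_{M∖z}^{(u−1)}(x) + [ρ(E ∖ x) = u]`
(the demand of `x` in `M ∖ z` at the level `u − 1`, plus one at the threshold). -/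
theorem demand_singleton_coloop_add {z : α} (hz : z ∈ gr M) (hzc : rk M ((gr M).erase z) + 1 = rk M (gr M))
    {u : ℕ} (hu : 2 ≤ u) {x : α} (hx : x ∈ (gr M).erase z) :
    demand M 1 u {x} = demand (M ＼ ({z} : Set α)) 1 u {x} + demand (M ＼ ({z} : Set α)) 1 (u - 1) {x} +
      (if rk M ((gr M).erase x) = u then 1 else 0) := by
  have hxz : x ≠ z := (mem_erase.1 hx).1
  have hdrop : rk M (((gr M).erase x).erase z) + 1 = rk M ((gr M).erase x) :=
    rk_erase_of_coloop hz hzc (erase_subset _ _) (mem_erase.2 ⟨Ne.symm hxz, hz⟩)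
  rw [demand_singleton_eq, demand_delete_singleton_eq, demand_delete_singleton_eq]
  by_cases h1 : u ≤ rk M ((gr M).erase x)
  · rw [if_pos h1]
    by_cases h2 : u = rk M ((gr M).erase x)
    · -- the threshold: `C(u, u−1) = 0 + C(u−1, u−2) + 1`
      rw [if_neg (by omega), if_pos (by omega), if_pos h2.symm, show rk M (((gr M).erase x).erase z) = u - 1 by omega,
        ← h2, Nat.choose_symm (by omega : 1 ≤ u), Nat.choose_one_right, Nat.choose_symm (by omega : 1 ≤ u - 1),
        Nat.choose_one_right]
      omega
    · -- above the threshold: Pascal `C(r, u−1) = C(r−1, u−1) + C(r−1, u−2)`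
      rw [if_pos (by omega), if_pos (by omega), if_neg (Ne.symm h2), add_zero,
        show rk M (((gr M).erase x).erase z) = rk M ((gr M).erase x) - 1 by omega, show u - 1 - 1 = u - 2 by omega]
      have := Nat.choose_succ_succ' (rk M ((gr M).erase x) - 1) (u - 2)
      rw [show rk M ((gr M).erase x) - 1 + 1 = rk M ((gr M).erase x) by omega,
        show u - 2 + 1 = u - 1 by omega] at this
      rw [this]
      ring
  · rw [if_neg h1, if_neg (by omega), if_neg (by omega), if_neg (by omega)]

/-- **THEOREM ((GM)_1 at a coloop)**: in a simple matroid of rank `≥ u + 1` (`u ≥ 2`), the co-rank-1 gap is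
deletion-monotone at every coloop `z`: `GapMonoQ M z 1 u`. -/
theorem gapMonoQ_one_of_simple_coloop (hs : Simple' M) {z : α} (hz : z ∈ gr M)
    (hzc : rk M ((gr M).erase z) + 1 = rk M (gr M)) {u : ℕ} (hu : 2 ≤ u) (hR : u + 1 ≤ rk M (gr M)) :
    GapMonoQ M z 1 u := by
  have hzI : M.Indep {z} := by
    have := hs {z} (singleton_subset_iff.2 hz) (by simp)
    rwa [coe_singleton] at this
  -- `z` is a coloop in Mathlib's sense, so `M ／ z = M ∖ z`
  have hzcol : M.IsColoop z := by
    rw [Matroid.isColoop_iff_notMem_closure_compl (by rw [← coe_gr]; exact_mod_cast hz)]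
    intro h
    have h' : z ∈ clF M ((gr M).erase z) := by
      rw [← mem_coe, coe_clF, coe_erase, coe_gr]
      exact h
    rw [mem_clF_iff_rk_insert_eq hz (erase_subset _ _), insert_erase hz] at h'
    omega
  have hcd : (M ／ ({z} : Set α)) = M ＼ ({z} : Set α) :=
    Matroid.contract_eq_delete_of_subset_coloops (by rw [Set.singleton_subset_iff]; exact hzcol)
  unfold GapMonoQ
  have hinj : ∀ (E : Finset α), ∀ x ∈ E, ∀ y ∈ E, ({x} : Finset α) = {y} → x = y :=
    fun _ x _ y _ h => singleton_inj.1 h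
  have hsN : Simple' (M ＼ ({z} : Set α)) := simple'_delete hs z
  have hgrN : gr (M ＼ ({z} : Set α)) = (gr M).erase z := gr_delete'
  have hrkN : rk (M ＼ ({z} : Set α)) (gr (M ＼ ({z} : Set α))) + 1 = rk M (gr M) := by
    rw [hgrN, rk_delete (Subset.refl _)]
    exact hzc
  -- the demand sums as sums over points
  have hD : ∑ B ∈ Rq M 1, demand M 1 u B = ∑ x ∈ gr M, demand M 1 u {x} := by
    rw [Rq_one_eq_image_singleton hs, sum_image (hinj _)]
  have hD' : ∀ v, ∑ B ∈ Rq (M ＼ ({z} : Set α)) 1, demand (M ＼ ({z} : Set α)) 1 v B =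
      ∑ x ∈ (gr M).erase z, demand (M ＼ ({z} : Set α)) 1 v {x} := by
    intro v
    rw [Rq_one_eq_image_singleton hsN, hgrN, sum_image (hinj _)]
  have hsplitD : ∑ x ∈ gr M, demand M 1 u {x} =
      demand M 1 u {z} + ∑ x ∈ (gr M).erase z, demand M 1 u {x} := (add_sum_erase _ _ hz).symm
  have hdz : demand M 1 u {z} = (rk M (gr M) - 1).choose (u - 1) := by
    rw [demand_singleton_eq, show rk M ((gr M).erase z) = rk M (gr M) - 1 by omega, if_pos (by omega)]
  have hrest : ∑ x ∈ (gr M).erase z, demand M 1 u {x} =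
      ∑ x ∈ (gr M).erase z, demand (M ＼ ({z} : Set α)) 1 u {x} +
        ∑ x ∈ (gr M).erase z, demand (M ＼ ({z} : Set α)) 1 (u - 1) {x} +
        (((gr M).erase z).filter (fun x => rk M ((gr M).erase x) = u)).card := by
    rw [sum_congr rfl (fun x hx => demand_singleton_coloop_add hz hzc hu hx), sum_add_distrib, sum_add_distrib,
      ← sum_filter, sum_const, smul_eq_mul, mul_one]
  -- the row `q = 1` of `N = M ∖ z` at the level `u − 1`
  have hrow : ∑ x ∈ (gr M).erase z, demand (M ＼ ({z} : Set α)) 1 (u - 1) {x} ≤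
      (u - 1) * (levelSet (M ＼ ({z} : Set α)) (u - 1)).card := by
    have h : ProfileIneq (M ＼ ({z} : Set α)) 1 (u - 1) :=
      hallIneq_one_all (M ＼ ({z} : Set α)) (u - 1) (by omega) (Rq (M ＼ ({z} : Set α)) 1) (subset_refl _) |>.trans
        (by exact_mod_cast card_le_card (filter_subset _ _))
    rw [profileIneq_iff_demand 1 (u - 1) (by omega) (by rw [Nat.choose_one_right]; omega), Nat.choose_one_right,
      hD'] at h
    exact h
  -- the basis bound
  have hbasis := choose_rk_le_card_levelSet (M ＼ ({z} : Set α)) u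
  rw [show rk (M ＼ ({z} : Set α)) (gr (M ＼ ({z} : Set α))) = rk M (gr M) - 1 by omega] at hbasis
  -- the threshold points are coloops of `N`, at most `ρ(N)` of them, and only when `ρ(N) = u`
  have hthr : (((gr M).erase z).filter (fun x => rk M ((gr M).erase x) = u)).card ≤
      if rk M (gr M) - 1 = u then u else 0 := by
    split_ifs with hRu
    · -- every such `x` is a coloop of `N`: `ρ_N(E' ∖ x) = u − 1 = ρ(N) − 1`
      have hsub : ((gr M).erase z).filter (fun x => rk M ((gr M).erase x) = u) ⊆
          coloops (M ＼ ({z} : Set α)) (gr (M ＼ ({z} : Set α))) := by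
        intro x hx
        rw [mem_filter] at hx
        obtain ⟨hxE, hxr⟩ := hx
        have hxz : x ≠ z := (mem_erase.1 hxE).1
        rw [mem_coloops, hgrN]
        refine ⟨hxE, fun hcl => ?_⟩
        have hX : ((gr M).erase z).erase x ⊆ (gr M).erase z := erase_subset _ _
        rw [mem_clF_iff_rk_insert_eq (by rw [hgrN]; exact hxE) (by rw [hgrN]; exact hX), insert_erase hxE,
          rk_delete (Subset.refl _), rk_delete hX, ← erase_erase_comm'] at hcl
        have hdrop : rk M (((gr M).erase x).erase z) + 1 = rk M ((gr M).erase x) :=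
          rk_erase_of_coloop hz hzc (erase_subset _ _) (mem_erase.2 ⟨Ne.symm hxz, hz⟩)
        omega
      have h := card_le_card hsub
      have h2 := card_coloops_le_rk (M := M ＼ ({z} : Set α)) (X := gr (M ＼ ({z} : Set α))) (Subset.refl _)
      omega
    · -- no point of `E ∖ z` has `ρ(E ∖ x) = u` when `ρ(E) − 1 ≠ u`: `ρ(E ∖ x) ≥ ρ(E) − 1 ≥ u + 1` or `= ρ(E)`
      apply Nat.le_zero.2
      rw [card_eq_zero, filter_eq_empty_iff]
      intro x hx hxr
      have hxz : x ≠ z := (mem_erase.1 hx).1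
      have hdrop : rk M (((gr M).erase x).erase z) + 1 = rk M ((gr M).erase x) :=
        rk_erase_of_coloop hz hzc (erase_subset _ _) (mem_erase.2 ⟨Ne.symm hxz, hz⟩)
      have h1 : rk M ((gr M).erase z) ≤ rk M (((gr M).erase x).erase z) + 1 := by
        have h := rk_insert_le (M := M) x (((gr M).erase z).erase x)
        rw [insert_erase hx, ← erase_erase_comm'] at h
        exact h
      omega
  -- the level sets: `W⁻(M) = levelSet M u`, `W⁻(N)` = `levelSet N u` minus `E ∖ z` when `ρ(N) = u`
  have hL : levelSetCoQ M 1 u = levelSet M u := levelSetCoQ_one_eq_levelSet (by omega)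
  have hL' : (levelSetCoQ (M ＼ ({z} : Set α)) 1 u).card + (if rk M (gr M) - 1 = u then 1 else 0) =
      (levelSet (M ＼ ({z} : Set α)) u).card := by
    split_ifs with hRu
    · -- `E ∖ z` is the one rank-`u` set of `N` with an empty complement
      have hmem : gr (M ＼ ({z} : Set α)) ∈ levelSet (M ＼ ({z} : Set α)) u := by
        rw [mem_levelSet]
        refine ⟨Subset.refl _, ?_⟩
        rw [← coe_rk]
        congr 1
        omega
      have heq : levelSetCoQ (M ＼ ({z} : Set α)) 1 u = (levelSet (M ＼ ({z} : Set α)) u).erase (gr (M ＼ ({z} : Set α))) := by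
        ext S
        rw [mem_levelSetCoQ, mem_erase, mem_levelSet]
        constructor
        · rintro ⟨h, h1⟩
          refine ⟨fun hSE => ?_, h⟩
          rw [hSE, sdiff_self] at h1
          unfold rk at h1
          simp at h1
        · rintro ⟨hne, h⟩
          refine ⟨h, ?_⟩
          by_contra hlt
          -- `ρ(E' ∖ S) = 0` forces `E' ∖ S = ∅` (no loops), i.e. `S = E'`
          have h0 : rk (M ＼ ({z} : Set α)) (gr (M ＼ ({z} : Set α)) \ S) = 0 := by omega
          apply hne
          apply Subset.antisymm h.1
          intro w hw
          by_contra hwS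
          have hwmem : w ∈ gr (M ＼ ({z} : Set α)) \ S := mem_sdiff.2 ⟨hw, hwS⟩
          have hind := hsN {w} (singleton_subset_iff.2 hw) (by simp)
          have hw1 : rk (M ＼ ({z} : Set α)) {w} = 1 := by
            rw [rk_eq_card_of_indep hind, card_singleton]
          have := rk_mono_sub (M := M ＼ ({z} : Set α)) (singleton_subset_iff.2 hwmem)
          omega
      rw [heq, card_erase_of_mem hmem]
      have : 0 < (levelSet (M ＼ ({z} : Set α)) u).card := card_pos.2 ⟨_, hmem⟩
      omega
    · rw [add_zero]
      congr 1
      apply levelSetCoQ_one_eq_levelSet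
      omega
  have hsplitL := card_levelSet_split hzI (u := u) (by omega)
  have hcdL : (levelSet (M ／ ({z} : Set α)) (u - 1)).card = (levelSet (M ＼ ({z} : Set α)) (u - 1)).card := by
    simp only [hcd]
  rw [hcdL] at hsplitL
  rw [hD, hD', hsplitD, hdz, hrest, hL, Nat.choose_one_right]
  -- assemble: `C(R−1,u−1) + D₁(N;u−1) + #thr ≤ u · (#levelSet N (u−1) + [R−1 = u])`
  have hfinal : (rk M (gr M) - 1).choose (u - 1) +
      ∑ x ∈ (gr M).erase z, demand (M ＼ ({z} : Set α)) 1 (u - 1) {x} +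
      (((gr M).erase z).filter (fun x => rk M ((gr M).erase x) = u)).card ≤
      u * ((levelSet (M ＼ ({z} : Set α)) (u - 1)).card + (if rk M (gr M) - 1 = u then 1 else 0)) := by
    have hu1 : u * (levelSet (M ＼ ({z} : Set α)) (u - 1)).card =
        (levelSet (M ＼ ({z} : Set α)) (u - 1)).card + (u - 1) * (levelSet (M ＼ ({z} : Set α)) (u - 1)).card := by
      have : u = 1 + (u - 1) := by omega
      calc u * (levelSet (M ＼ ({z} : Set α)) (u - 1)).card
          = (1 + (u - 1)) * (levelSet (M ＼ ({z} : Set α)) (u - 1)).card := by rw [← this]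
        _ = _ := by ring
    split_ifs at hthr ⊢ with hRu
    · rw [Nat.mul_add, hu1, Nat.mul_one]
      omega
    · rw [add_zero, hu1]
      omega
  have hn : u * (levelSet M u).card = u * (levelSetCoQ (M ＼ ({z} : Set α)) 1 u).card +
      u * ((levelSet (M ＼ ({z} : Set α)) (u - 1)).card + (if rk M (gr M) - 1 = u then 1 else 0)) := by
    rw [hsplitL, ← hL']
    ring
  rw [hn]
  omega

/-- **THEOREM ((GM)_1 at every point of every simple matroid)**: `GapMonoQ M z 1 u` for every simple matroid `M`,
every `z ∈ E` and every `u ≥ 2`. -/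
theorem gapMonoQ_one_of_simple_all (hs : Simple' M) {z : α} (hz : z ∈ gr M) {u : ℕ} (hu : 2 ≤ u) :
    GapMonoQ M z 1 u := by
  rcases Nat.lt_or_ge (rk M (gr M)) u with hlt | hge
  · exact gapMonoQ_of_rk_lt hlt z
  · rcases Nat.eq_or_lt_of_le hge with heq | hgt
    · exact gapMonoQ_of_rk_eq heq.symm (by omega) z hz
    · have h1 : rk M ((gr M).erase z) ≤ rk M (gr M) := rk_mono_sub (erase_subset _ _)
      have h2 : rk M (gr M) ≤ rk M ((gr M).erase z) + 1 := by
        have h := rk_insert_le (M := M) z ((gr M).erase z)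
        rw [insert_erase hz] at h
        exact h
      rcases Nat.eq_or_lt_of_le h1 with hnc | hcol
      · exact gapMonoQ_one_of_simple hs hz hnc hu (by omega)
      · exact gapMonoQ_one_of_simple_coloop hs hz (by omega) hu (by omega)

end PercRepro.Cogirth
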